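import Summits.AtomisticToContinuum.Crystallization.Theorems.FrustratedLawDichotomyStrainedPatchHomEntryFitHcpUCollarLeaf
import Summits.AtomisticToContinuum.Crystallization.Theorems.FrustratedLawDichotomyStrainedPatchHomValueT2Guard

/-!
# The U-COLLAR, second edition: the two worst-case constants of #28/#29 read from the DATA (reach ≈ ×2)

decomp-a2c hand-2 g41 — structural share for the crux `AperiodicFrustratedLawGap` (stmt-AtomisticToContinuum-27623; `(H) HomFloor`, hcp half).
#28 `perturbU` carries the constant `31/10` (A-site far clause at the WORST case `dhi + ρ = 3/2`) and #29 reads the relative size of the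
perturbation against the WINDOW (`‖U'v‖ ≥ (3/4)‖v‖`, factor `4/3`).  Both are data: the thin certificate KNOWS `dhi = (dEnclH c₀ w₀).hi/SC ≈ 0.97`
(constant `≈ 1.95`, so `2` serves) and the base strain is the explicit `cenMap c₀` with `‖cenMap c₀ − 1‖ ≤ √(Σ (c₀ − δ·SC)²)/SC ≈ 0.03–0.07`
(factor `≈ 1.05`).  This file:

* §1 ★★ `perturbUc` — #28's `perturbU` with the constant a PARAMETER `cst`: hypotheses `2 ≤ cst`, `26/10·dhi + 1/100 + 13/10·ρ ≤ 13/10·cst`,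
  `cst·κ ≤ ρ` ⟹ `HcpFitCoreRobust U' ξ R η' ((1 − κ)dlo) ((1 + κ)dhi) (ρ − cst·κ) (e₀ + 13/5·κ·dlo)`; `hcpLeafGoal_of_perturbUc_collar`;
* §2 `rel_of_opNorm_base` — the relative bound against the BASE: `‖U − 1‖ ≤ κc < 1`, `‖U' − U‖ ≤ κ₀` ⟹ `κ = κ₀/(1 − κc)`; `norm_cenMap_sub_one_le_sqrt`
  (Frobenius, any centre; the tree's `norm_cenMap_sub_one_le` is the `1/4` instance);
* §3 the Boolean `uCollarCellBOK c₀ w₀ ρS hi cN Kc K Mx c w` (extra integer data: `cN = 10·cst ≥ 20`, witness `Kc ≥ √(Σ (c₀ − δ·SC)²)`, `Kc < SC`;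
  `hi := (dEnclH c₀ w₀).hi` precomputed) with the budget `10·Mx·(SC − Kc) + cN·K·SC² ≤ 10·ρS·SC·(SC − Kc)` (⟺ `Mx/SC² + cst·κ ≤ ρS/SC`,
  `κ = K/(SC − Kc)`) and the far-clause line `260·hi + SC + 130·ρS ≤ 13·cN·SC`; leaf / list editions and ★★ `semOKHQ_of_uCollarLeafBOK`,
  `semFactsQ_of_uCollarLeavesBOK(_map)`.

At the RHO-90 centre (`hi/SC ≈ 0.970`, `‖cenMap c₀ − 1‖_F ≈ 0.05`): `cst = 2` and factor `1.05` instead of `31/10` and `4/3` — point-cell reach `ρ/2.1`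
instead of `ρ/4.1`.  Pure bookkeeping + triangle inequalities; 0 sorry; standard axioms; no instances / notation.  `--supports stmt-AtomisticToContinuum-27623`.
-/

noncomputable section

namespace Summit.AtomisticToContinuum.Crystallization.Theorems.FrustratedLawDichotomyStrainedPatchHomEntryFitHcpUCollarLeafB

open scoped BigOperators RealInnerProductSpace
open Literature.Analysis.ValidatedNumerics.Numerics
open Summit.AtomisticToContinuum.Crystallization.Theorems.ChargedEnergyGapNegative (E3)
open Summit.AtomisticToContinuum.Crystallization.Theorems.FrustratedLawDichotomyStrainedPatchHomSplit
open Summit.AtomisticToContinuum.Crystallization.Theorems.FrustratedLawDichotomyStrainedPatchHomEntryHcpFrame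
open Summit.AtomisticToContinuum.Crystallization.Theorems.FrustratedLawDichotomyStrainedPatchHomEntryLeafHT (HcpLeafGoal)
open Summit.AtomisticToContinuum.Crystallization.Theorems.FrustratedLawDichotomyStrainedPatchHomParamTransfer
open Summit.AtomisticToContinuum.Crystallization.Theorems.FrustratedLawDichotomyStrainedPatchHomParamTransferMul (norm_nbrU_rel_bounds norm_nbrU_sub_le_rel
  le_norm_latPt_rel le_norm_latPt_add_rel opNorm_sub_le_of_entries)
open Summit.AtomisticToContinuum.Crystallization.Theorems.FrustratedLawDichotomyStrainedPatchHomCurvCentreKit (cenMap cenMap_entry)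
open Summit.AtomisticToContinuum.Crystallization.Theorems.FrustratedLawDichotomyStrainedPatchHomValueT2Kit (idZ)
open Summit.AtomisticToContinuum.Crystallization.Theorems.FrustratedLawDichotomyStrainedPatchHomEntryFitHcpKit (dEnclH)
open Summit.AtomisticToContinuum.Crystallization.Theorems.FrustratedLawDichotomyStrainedPatchHomEntryFitHcpCentred (fitOKHDCRSρ fitOKHDCRSρ_sound)
open Summit.AtomisticToContinuum.Crystallization.Theorems.FrustratedLawDichotomyStrainedPatchHomEntrySemanticQuot (semOKHQ semOKHQ_of_sound)
open Summit.AtomisticToContinuum.Crystallization.Theorems.FrustratedLawDichotomyStrainedPatchHomEntryFitHcpSharpCollar (xiCollarSharpOK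
  xiCollarSharpOK_spec norm_apply_sub_le_of_sharp exists_clamp_near_coord)
open Summit.AtomisticToContinuum.Crystallization.Theorems.FrustratedLawDichotomyStrainedPatchHomEntryFitHcpUCollarLeaf (cenMap_selfAdjoint
  cenMap_box_of_nonneg abs_entry_sub_cenMap_le uExcessSq)

/-! ## §1. `perturbU` with the far-clause constant read from `dhi` -/

section Perturb
variable {U U' : E3 →L[ℝ] E3} {ξ ξ' : E3} {R : E3 →ₗᵢ[ℝ] E3} {η' dlo dhi ρ e₀ κ cst : ℝ}

/-- ★★ **U-PERTURBATION, parametric constant**: as `…ParamTransferMul.perturbU` with `31/10` replaced by any `cst ≥ 2` satisfying the A-site far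
line `26/10·dhi + 1/100 + 13/10·ρ ≤ 13/10·cst` (so `cst = 2` whenever `dhi ≤ 0.99`). [triangle inequalities] -/
theorem perturbUc (h : HcpFitCoreRobust U ξ R η' dlo dhi ρ e₀) (hrel : ∀ v : E3, ‖U' v - U v‖ ≤ κ * ‖U v‖) (hκ0 : 0 ≤ κ)
    (hc2 : 2 ≤ cst) (hfar : 26 / 10 * dhi + 1 / 100 + 13 / 10 * ρ ≤ 13 / 10 * cst) (hκ : cst * κ ≤ ρ) :
    HcpFitCoreRobust U' ξ R η' ((1 - κ) * dlo) ((1 + κ) * dhi) (ρ - cst * κ) (e₀ + 13 / 5 * κ * dlo) := by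
  have hρ0 := h.hρ0
  have hρ := h.hρ
  have hdhiρ := h.hdhi
  obtain ⟨k₁, hk₁⟩ := h.hhi
  have hdlodhi : dlo ≤ dhi := (h.hlo k₁).trans hk₁
  have hdlo0 : 0 < dlo := lt_of_le_of_lt hρ0 hρ
  have hdhi32 : dhi ≤ 3 / 2 := by linarith
  have hcκ0 : 0 ≤ cst * κ := by nlinarith
  have hκdlo : κ * dlo ≤ cst * κ := by nlinarith
  have hκdhi : κ * dhi ≤ cst * κ := by nlinarith
  have hκ1 : κ < 1 := by nlinarith
  have h1κ : 0 ≤ 1 - κ := by linarith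
  have hbd := norm_nbrU_rel_bounds hrel ξ
  have hM : ∀ k, ‖nbrU U ξ k‖ ≤ 13 / 10 * dlo := fun k => by linarith [h.hcl k]
  have hup : ∀ k, ‖nbrU U' ξ k‖ ≤ ‖nbrU U ξ k‖ + κ * (13 / 10 * dlo) := fun k => by
    have := (hbd k).2
    have := mul_le_mul_of_nonneg_left (hM k) hκ0
    nlinarith [norm_nonneg (nbrU U ξ k)]
  refine ⟨h.hη0, h.hη, by linarith, ?_, ?_, fun k => ?_, ⟨k₁, ?_⟩, fun k k' hmin => ?_, ?_, fun k => ?_,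
    fun b hb hb0 hl => ?_, fun b hb hl => ?_⟩
  · nlinarith
  · nlinarith
  · have := (hbd k).1
    nlinarith [h.hlo k]
  · have := (hbd k₁).2
    nlinarith
  · obtain ⟨k₀, -, hk₀⟩ := Finset.exists_min_image Finset.univ (fun j : Fin 12 => ‖nbrU U ξ j‖) Finset.univ_nonempty
    have hmin₀ : ∀ j, ‖nbrU U ξ k₀‖ ≤ ‖nbrU U ξ j‖ := fun j => hk₀ j (Finset.mem_univ j)
    have hf := h.hfit k k₀ hmin₀
    have hval : |‖nbrU U' ξ k'‖ - ‖nbrU U ξ k₀‖| ≤ κ * (13 / 10 * dlo) := by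
      rw [abs_le]
      constructor
      · have h1 := (hbd k').1
        have h2 := mul_le_mul_of_nonneg_left (hmin₀ k') h1κ
        have h3 := mul_le_mul_of_nonneg_left (hM k₀) hκ0
        nlinarith
      · have h1 := hmin k₀
        have h2 := hup k₀
        linarith
    have hR : ‖R (nbr k)‖ = 1 := by rw [LinearIsometry.norm_map, norm_nbr]
    have hdec : nbrU U' ξ k - ‖nbrU U' ξ k'‖ • R (nbr k) =
        (nbrU U ξ k - ‖nbrU U ξ k₀‖ • R (nbr k)) + (nbrU U' ξ k - nbrU U ξ k) - (‖nbrU U' ξ k'‖ - ‖nbrU U ξ k₀‖) • R (nbr k) := by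
      rw [sub_smul]; abel
    rw [hdec]
    refine (norm_sub_le _ _).trans ?_
    have h1 := norm_add_le (nbrU U ξ k - ‖nbrU U ξ k₀‖ • R (nbr k)) (nbrU U' ξ k - nbrU U ξ k)
    have h2 : ‖(‖nbrU U' ξ k'‖ - ‖nbrU U ξ k₀‖) • R (nbr k)‖ ≤ κ * (13 / 10 * dlo) := by
      rw [norm_smul, hR, mul_one, Real.norm_eq_abs]; exact hval
    have h3 : ‖nbrU U' ξ k - nbrU U ξ k‖ ≤ κ * (13 / 10 * dlo) :=
      (norm_nbrU_sub_le_rel hrel ξ k).trans (mul_le_mul_of_nonneg_left (hM k) hκ0)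
    nlinarith
  · have he := h.he
    have hη0 := h.hη0
    have h1 : 0 ≤ η' * (cst * κ - κ * dlo) := mul_nonneg hη0 (by linarith)
    nlinarith
  · have h1 := hup k
    have h2 := h.hcl k
    nlinarith
  · have hF := h.hfarA b hb hb0 hl
    have hL := le_norm_latPt_rel hrel hexFrame b
    have h1 : (1 - κ) * (13 / 10 * dhi + 1 / 100 + 13 / 10 * ρ) ≤ (1 - κ) * ‖latPt U hexFrame b‖ := mul_le_mul_of_nonneg_left hF h1κ
    have h2 : κ * (26 / 10 * dhi + 1 / 100 + 13 / 10 * ρ) ≤ κ * (13 / 10 * cst) := mul_le_mul_of_nonneg_left hfar hκ0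
    nlinarith
  · have hF := h.hfarB b hb hl
    have hL := le_norm_latPt_add_rel hrel hexFrame b (hcpShift + ξ)
    have h1 : (1 - κ) * (13 / 10 * dhi + 1 / 100 + 23 / 10 * ρ) ≤ (1 - κ) * ‖latPt U hexFrame b + U (hcpShift + ξ)‖ :=
      mul_le_mul_of_nonneg_left hF h1κ
    have h2 : κ * (26 / 10 * dhi + 1 / 100 + 13 / 10 * ρ) ≤ κ * (13 / 10 * cst) := mul_le_mul_of_nonneg_left hfar hκ0
    have h3 : κ * ρ ≤ κ * cst := mul_le_mul_of_nonneg_left (by linarith) hκ0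
    nlinarith

/-- ★★ The 9-dimensional collar with the parametric constant. [`perturbUc` ∘ `shift` ∘ landed goodness theorem] -/
theorem hcpLeafGoal_of_perturbUc_collar (h : HcpFitCoreRobust U ξ R η' dlo dhi ρ e₀) (hrel : ∀ v : E3, ‖U' v - U v‖ ≤ κ * ‖U v‖)
    (hκ0 : 0 ≤ κ) (hc2 : 2 ≤ cst) (hfar : 26 / 10 * dhi + 1 / 100 + 13 / 10 * ρ ≤ 13 / 10 * cst) (hκ : cst * κ ≤ ρ)
    (hρ' : ‖U' (ξ' - ξ)‖ ≤ ρ - cst * κ) (hU' : ‖U' - 1‖ ≤ 1 / 4) (hξ' : ‖ξ'‖ ≤ 1 / 2) (μ : ℤ) : HcpLeafGoal μ U' ξ' :=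
  ((perturbUc h hrel hκ0 hc2 hfar hκ).shift hρ').hcpLeafGoal hU' hξ' μ

end Perturb

/-! ## §2. The relative bound against the BASE strain; the Frobenius distance of `cenMap c₀` from the identity -/

/-- ★ `‖U − 1‖ ≤ κc < 1` and `‖U' − U‖ ≤ κ₀` ⟹ `‖U'v − Uv‖ ≤ κ₀/(1 − κc)·‖Uv‖`. [triangle inequalities] -/
theorem rel_of_opNorm_base {U U' : E3 →L[ℝ] E3} {κ₀ κc : ℝ} (hU : ‖U - 1‖ ≤ κc) (hlt : κc < 1) (hκ₀ : ‖U' - U‖ ≤ κ₀) (v : E3) :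
    ‖U' v - U v‖ ≤ κ₀ / (1 - κc) * ‖U v‖ := by
  have hκ00 : 0 ≤ κ₀ := (norm_nonneg _).trans hκ₀
  have hd : 0 < 1 - κc := by linarith
  have h1 : ‖U' v - U v‖ ≤ κ₀ * ‖v‖ := by
    have e : U' v - U v = (U' - U) v := rfl
    rw [e]
    exact (ContinuousLinearMap.le_opNorm _ _).trans (mul_le_mul_of_nonneg_right hκ₀ (norm_nonneg _))
  have h3 : ‖(U - 1) v‖ ≤ κc * ‖v‖ := (ContinuousLinearMap.le_opNorm _ _).trans (mul_le_mul_of_nonneg_right hU (norm_nonneg _))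
  have h4 : ‖v‖ ≤ ‖U v‖ + ‖(U - 1) v‖ := by
    have e : (U - 1) v = U v - v := by simp
    rw [e]
    have := norm_le_insert' v (U v)
    rwa [norm_sub_rev] at this
  have h5 : (1 - κc) * ‖v‖ ≤ ‖U v‖ := by nlinarith [norm_nonneg v]
  rw [div_mul_eq_mul_div, le_div_iff₀ hd]
  calc ‖U' v - U v‖ * (1 - κc) ≤ κ₀ * ‖v‖ * (1 - κc) := mul_le_mul_of_nonneg_right h1 hd.le
    _ = κ₀ * ((1 - κc) * ‖v‖) := by ring
    _ ≤ κ₀ * ‖U v‖ := mul_le_mul_of_nonneg_left h5 hκ00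

/-- The Frobenius distance of the centre strain from the identity: `‖cenMap c₀ − 1‖ ≤ √(Σ_kl (c₀_kl − δ_kl·SC)²)/SC`. [Frobenius] -/
theorem norm_cenMap_sub_one_le_sqrt (c₀ : (Fin 3 × Fin 3) ⊕ Fin 3 → ℤ) :
    ‖cenMap c₀ - 1‖ ≤ Real.sqrt (((∑ k : Fin 3, ∑ l : Fin 3, (c₀ (Sum.inl (k, l)) - idZ k l) ^ 2 : ℤ) : ℝ)) / SC := by
  have hS : (0 : ℝ) < SC := SC_pos
  have h1 := opNorm_sub_le_of_entries (U' := cenMap c₀) (U := (1 : E3 →L[ℝ] E3))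
    (ε := fun k l => |(((c₀ (Sum.inl (k, l)) - idZ k l : ℤ) : ℝ))| / SC) (fun k l => by
      have e : (cenMap c₀ (EuclideanSpace.single l (1 : ℝ))) k - ((1 : E3 →L[ℝ] E3) (EuclideanSpace.single l (1 : ℝ))) k =
          (((c₀ (Sum.inl (k, l)) - idZ k l : ℤ) : ℝ)) / SC := by
        rw [cenMap_entry]
        by_cases hkl : k = l
        · subst hkl
          simp [idZ]
          field_simp
        · simp [idZ, hkl]
      rw [e, abs_div, abs_of_pos hS])
  have h2 : ∑ k : Fin 3, ∑ l : Fin 3, (|(((c₀ (Sum.inl (k, l)) - idZ k l : ℤ) : ℝ))| / SC) ^ 2 =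
      (((∑ k : Fin 3, ∑ l : Fin 3, (c₀ (Sum.inl (k, l)) - idZ k l) ^ 2 : ℤ)) : ℝ) / SC ^ 2 := by
    push_cast [Finset.sum_div]
    refine Finset.sum_congr rfl fun k _ => Finset.sum_congr rfl fun l _ => ?_
    rw [div_pow, sq_abs]
  rw [h2, Real.sqrt_div' _ (by positivity), Real.sqrt_sq hS.le] at h1
  exact h1

/-! ## §3. The Boolean leaf, second edition -/

/-- The squared Frobenius distance of the centre from the identity (scale `SC²`). -/
def cenDevSq (c₀ : (Fin 3 × Fin 3) ⊕ Fin 3 → ℤ) : ℤ := ∑ k : Fin 3, ∑ l : Fin 3, (c₀ (Sum.inl (k, l)) - idZ k l) ^ 2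

/-- ★ The U-collar cell test, second edition (`cN = 10·cst`, witnesses `Kc ≥ √cenDevSq`, `K ≥ √E`, `Mx ≥ √X`; `hi = (dEnclH c₀ w₀).hi`). -/
def uCollarCellBOK (c₀ w₀ : (Fin 3 × Fin 3) ⊕ Fin 3 → ℤ) (ρS hi cN Kc K Mx : ℤ) (c w : (Fin 3 × Fin 3) ⊕ Fin 3 → ℤ) : Bool :=
  ((List.finRange 3).all fun a => (List.finRange 3).all fun b =>
      decide (0 ≤ w₀ (Sum.inl (a, b))) && decide (c₀ (Sum.inl (a, b)) = c₀ (Sum.inl (b, a)))) &&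
    decide (0 < ρS) && decide (20 ≤ cN) && decide (260 * hi + SC + 130 * ρS ≤ 13 * cN * SC) &&
    decide (0 ≤ Kc) && decide (cenDevSq c₀ ≤ Kc ^ 2) && decide (Kc < SC) &&
    decide (0 ≤ K) && decide (uExcessSq c₀ c w ≤ K ^ 2) && decide (0 ≤ Mx) &&
    xiCollarSharpOK Mx (ρS * SC) c₀ w₀ ρS c w &&
    decide (10 * Mx * (SC - Kc) + cN * K * SC ^ 2 ≤ 10 * ρS * SC * (SC - Kc))

/-- ★ The U-collar leaf, second edition. -/
def uCollarLeafBOK (c₀ w₀ : (Fin 3 × Fin 3) ⊕ Fin 3 → ℤ) (q : Fin 4 → ℤ) (ρS e0S cN Kc K Mx : ℤ) (c w : (Fin 3 × Fin 3) ⊕ Fin 3 → ℤ) : Bool :=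
  uCollarCellBOK c₀ w₀ ρS (dEnclH c₀ w₀).hi cN Kc K Mx c w && fitOKHDCRSρ c₀ w₀ q ρS e0S

/-- ONE thin certificate (+ its `hi`, + one centre witness `Kc`, + one constant `cN`) and a LIST of cells `(K, Mx, c, w)`. -/
def uCollarLeavesBOK (c₀ w₀ : (Fin 3 × Fin 3) ⊕ Fin 3 → ℤ) (q : Fin 4 → ℤ) (ρS e0S cN Kc : ℤ)
    (L : List (ℤ × ℤ × ((Fin 3 × Fin 3) ⊕ Fin 3 → ℤ) × ((Fin 3 × Fin 3) ⊕ Fin 3 → ℤ))) : Bool :=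
  let hi := (dEnclH c₀ w₀).hi
  fitOKHDCRSρ c₀ w₀ q ρS e0S && L.all fun b => uCollarCellBOK c₀ w₀ ρS hi cN Kc b.1 b.2.1 b.2.2.1 b.2.2.2

/-- Reading `uCollarCellBOK`. [formal bookkeeping] -/
theorem uCollarCellBOK_spec {c₀ w₀ c w : (Fin 3 × Fin 3) ⊕ Fin 3 → ℤ} {ρS hi cN Kc K Mx : ℤ} (h : uCollarCellBOK c₀ w₀ ρS hi cN Kc K Mx c w = true) :
    (∀ ab : Fin 3 × Fin 3, 0 ≤ w₀ (Sum.inl ab)) ∧ (∀ a b : Fin 3, c₀ (Sum.inl (a, b)) = c₀ (Sum.inl (b, a))) ∧ 0 < ρS ∧ 20 ≤ cN ∧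
      260 * hi + SC + 130 * ρS ≤ 13 * cN * SC ∧ 0 ≤ Kc ∧ cenDevSq c₀ ≤ Kc ^ 2 ∧ Kc < SC ∧ 0 ≤ K ∧ uExcessSq c₀ c w ≤ K ^ 2 ∧ 0 ≤ Mx ∧
      xiCollarSharpOK Mx (ρS * SC) c₀ w₀ ρS c w = true ∧ 10 * Mx * (SC - Kc) + cN * K * SC ^ 2 ≤ 10 * ρS * SC * (SC - Kc) := by
  simp only [uCollarCellBOK, List.all_eq_true, List.mem_finRange, true_implies, Bool.and_eq_true, decide_eq_true_eq] at h
  obtain ⟨⟨⟨⟨⟨⟨⟨⟨⟨⟨⟨hwb, hρ⟩, hcN⟩, hfar⟩, hKc⟩, hdev⟩, hKc1⟩, hK⟩, hE⟩, hMx⟩, hsharp⟩, hbud⟩ := h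
  exact ⟨fun ab => (hwb ab.1 ab.2).1, fun a b => (hwb a b).2, hρ, hcN, hfar, hKc, hdev, hKc1, hK, hE, hMx, hsharp, hbud⟩

/-- ★★ **U-COLLAR CELL (2nd ed.) ⟹ hcp leaf goal** at every admissible `(U', ξ')` of the cell, every level. [bookkeeping over `fitOKHDCRSρ_sound` at
`cenMap c₀` + `hcpLeafGoal_of_perturbUc_collar`] -/
theorem hcpLeafGoal_of_uCollarCellBOK {c₀ w₀ c w : (Fin 3 × Fin 3) ⊕ Fin 3 → ℤ} {q : Fin 4 → ℤ} {ρS e0S cN Kc K Mx : ℤ}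
    (hcell : uCollarCellBOK c₀ w₀ ρS (dEnclH c₀ w₀).hi cN Kc K Mx c w = true) (hfit : fitOKHDCRSρ c₀ w₀ q ρS e0S = true)
    (U' : E3 →L[ℝ] E3) (ξ' : E3) (hU' : ‖U' - 1‖ ≤ 1 / 4) (hξ' : ‖ξ'‖ ≤ 1 / 4)
    (hbox : ∀ ab : Fin 3 × Fin 3, |(U' (EuclideanSpace.single ab.2 (1 : ℝ))) ab.1 - (c (Sum.inl ab) : ℝ) / SC| ≤ (w (Sum.inl ab) : ℝ) / SC)
    (hξb : ∀ i : Fin 3, |ξ' i - (c (Sum.inr i) : ℝ) / SC| ≤ (w (Sum.inr i) : ℝ) / SC) (μ : ℤ) : HcpLeafGoal μ U' ξ' := by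
  obtain ⟨hw₀U, hsym, hρS, hcN, hfarI, hKc, hdev, hKc1, hK, hE, hMx, hsharp, hbud⟩ := uCollarCellBOK_spec hcell
  have hS : (0 : ℝ) < SC := SC_pos
  have hw₀ξ : ∀ i : Fin 3, (0 : ℤ) ≤ w₀ (Sum.inr i) := (xiCollarSharpOK_spec hsharp).1
  set U : E3 →L[ℝ] E3 := cenMap c₀ with hUdef
  have hsaU : ∀ v v' : E3, ⟪U v, v'⟫ = ⟪v, U v'⟫ := cenMap_selfAdjoint hsym
  have hbox₀ : ∀ ab : Fin 3 × Fin 3,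
      |(U (EuclideanSpace.single ab.2 (1 : ℝ))) ab.1 - (c₀ (Sum.inl ab) : ℝ) / SC| ≤ (w₀ (Sum.inl ab) : ℝ) / SC := cenMap_box_of_nonneg hw₀U
  obtain ⟨ξ, hξT, hδ⟩ := exists_clamp_near_coord hw₀ξ hξb
  obtain ⟨-, R, hR⟩ := fitOKHDCRSρ_sound hfit U ξ hsaU hbox₀ hξT
  have hR' : HcpFitCoreRobust U ξ R (4999 / 100000) (((dEnclH c₀ w₀).lo : ℝ) / SC) (((dEnclH c₀ w₀).hi : ℝ) / SC) ((ρS : ℝ) / SC)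
      ((e0S : ℝ) / SC) := hR
  -- `‖U − 1‖ ≤ Kc/SC < 1`
  have hKc0 : (0 : ℝ) ≤ Kc := by exact_mod_cast hKc
  have hκc : ‖U - 1‖ ≤ (Kc : ℝ) / SC := by
    refine (norm_cenMap_sub_one_le_sqrt c₀).trans (div_le_div_of_nonneg_right ?_ hS.le)
    have hdev' : ((cenDevSq c₀ : ℤ) : ℝ) ≤ (Kc : ℝ) ^ 2 := by exact_mod_cast hdev
    calc Real.sqrt (((∑ k : Fin 3, ∑ l : Fin 3, (c₀ (Sum.inl (k, l)) - idZ k l) ^ 2 : ℤ) : ℝ))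
        ≤ Real.sqrt ((Kc : ℝ) ^ 2) := Real.sqrt_le_sqrt hdev'
      _ = Kc := Real.sqrt_sq hKc0
  have hκc1 : (Kc : ℝ) / SC < 1 := by rw [div_lt_one hS]; exact_mod_cast hKc1
  -- `‖U' − U‖ ≤ K/SC`
  have hK0 : (0 : ℝ) ≤ K := by exact_mod_cast hK
  have hκ₀ : ‖U' - U‖ ≤ (K : ℝ) / SC := by
    have h1 := opNorm_sub_le_of_entries (U' := U') (U := U)
      (ε := fun a b => ((|c (Sum.inl (a, b)) - c₀ (Sum.inl (a, b))| + w (Sum.inl (a, b)) : ℤ) : ℝ) / SC)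
      (fun a b => abs_entry_sub_cenMap_le hbox a b)
    have h2 : ∑ a : Fin 3, ∑ b : Fin 3, (((|c (Sum.inl (a, b)) - c₀ (Sum.inl (a, b))| + w (Sum.inl (a, b)) : ℤ) : ℝ) / SC) ^ 2 =
        ((uExcessSq c₀ c w : ℤ) : ℝ) / SC ^ 2 := by
      push_cast [uExcessSq, Finset.sum_div]
      refine Finset.sum_congr rfl fun a _ => Finset.sum_congr rfl fun b _ => ?_
      rw [div_pow]
    rw [h2, Real.sqrt_div' _ (by positivity), Real.sqrt_sq hS.le] at h1
    refine h1.trans (div_le_div_of_nonneg_right ?_ hS.le)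
    have hEr : ((uExcessSq c₀ c w : ℤ) : ℝ) ≤ (K : ℝ) ^ 2 := by exact_mod_cast hE
    calc Real.sqrt ((uExcessSq c₀ c w : ℤ) : ℝ) ≤ Real.sqrt ((K : ℝ) ^ 2) := Real.sqrt_le_sqrt hEr
      _ = K := Real.sqrt_sq hK0
  -- the relative bound with `κ = (K/SC)/(1 − Kc/SC) = K/(SC − Kc)`
  have hrel := rel_of_opNorm_base hκc hκc1 hκ₀
  have hKcS : (Kc : ℝ) < SC := by exact_mod_cast hKc1
  have hD : (0 : ℝ) < SC - Kc := by linarith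
  have hκeq : (K : ℝ) / SC / (1 - (Kc : ℝ) / SC) = K / (SC - Kc) := by
    have hS0 : (SC : ℝ) ≠ 0 := ne_of_gt hS
    have h1 : (1 : ℝ) - Kc / SC = (SC - Kc) / SC := by field_simp
    rw [h1, div_div_eq_mul_div, div_mul_cancel₀ _ hS0]
  rw [hκeq] at hrel
  have hκ0 : (0 : ℝ) ≤ (K : ℝ) / (SC - Kc) := div_nonneg hK0 hD.le
  -- the constant `cst = cN/10` and its two lines
  set cst : ℝ := (cN : ℝ) / 10 with hcst
  have hc2 : 2 ≤ cst := by rw [hcst, le_div_iff₀ (by norm_num)]; exact_mod_cast hcN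
  have hfar : 26 / 10 * ((((dEnclH c₀ w₀).hi : ℤ) : ℝ) / SC) + 1 / 100 + 13 / 10 * ((ρS : ℝ) / SC) ≤ 13 / 10 * cst := by
    have h1 : (260 : ℝ) * ((dEnclH c₀ w₀).hi : ℤ) + SC + 130 * ρS ≤ 13 * cN * SC := by exact_mod_cast hfarI
    rw [hcst]
    have e : 26 / 10 * ((((dEnclH c₀ w₀).hi : ℤ) : ℝ) / SC) + 1 / 100 + 13 / 10 * ((ρS : ℝ) / SC) =
        (260 * (((dEnclH c₀ w₀).hi : ℤ) : ℝ) + SC + 130 * ρS) / (100 * SC) := by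
      field_simp
      ring
    rw [e, div_le_iff₀ (by positivity)]
    nlinarith
  -- the budget: `Mx/SC² + cst·κ ≤ ρS/SC`
  have hMx0 : (0 : ℝ) ≤ Mx := by exact_mod_cast hMx
  have hbudr : (10 : ℝ) * Mx * (SC - Kc) + cN * K * (SC : ℝ) ^ 2 ≤ 10 * ρS * SC * (SC - Kc) := by exact_mod_cast hbud
  have key : (ρS : ℝ) / SC - cst * ((K : ℝ) / (SC - Kc)) - (Mx : ℝ) / (SC : ℝ) ^ 2 =
      (10 * ρS * SC * (SC - Kc) - cN * K * (SC : ℝ) ^ 2 - 10 * Mx * (SC - Kc)) / (10 * (SC : ℝ) ^ 2 * (SC - Kc)) := by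
    rw [hcst]
    field_simp
  have hfrac : 0 ≤ (ρS : ℝ) / SC - cst * ((K : ℝ) / (SC - Kc)) - (Mx : ℝ) / (SC : ℝ) ^ 2 := by
    rw [key]; exact div_nonneg (by linarith) (by positivity)
  have hMx' : 0 ≤ (Mx : ℝ) / (SC : ℝ) ^ 2 := by positivity
  have hκ : cst * ((K : ℝ) / (SC - Kc)) ≤ (ρS : ℝ) / SC := by linarith
  -- the ξ-collar
  have hρSr : (0 : ℝ) ≤ ρS := by exact_mod_cast hρS.le
  have hsD : 0 < ρS * SC := mul_pos hρS (by exact_mod_cast Nat.pos_of_ne_zero (by norm_num [SC]))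
  have hnear := norm_apply_sub_le_of_sharp hsharp hsD hρSr hMx0 hbox hδ
  have hMxeq : ((Mx : ℤ) : ℝ) / ((ρS * SC : ℤ) : ℝ) * ((ρS : ℝ) / SC) = (Mx : ℝ) / (SC : ℝ) ^ 2 := by
    have hρ0 : (ρS : ℝ) ≠ 0 := ne_of_gt (by exact_mod_cast hρS)
    push_cast
    field_simp
  rw [hMxeq] at hnear
  have hρ' : ‖U' (ξ' - ξ)‖ ≤ (ρS : ℝ) / SC - cst * ((K : ℝ) / (SC - Kc)) := hnear.trans (by linarith)
  have hξ'2 : ‖ξ'‖ ≤ 1 / 2 := hξ'.trans (by norm_num)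
  exact hcpLeafGoal_of_perturbUc_collar hR' hrel hκ0 hc2 hfar hκ hρ' hU' hξ'2 μ

/-- ★★ **SOUNDNESS IN THE QUOTIENT CURRENCY** (2nd ed.). [formal bookkeeping] -/
theorem semOKHQ_of_uCollarLeafBOK {μ : ℤ} {c₀ w₀ c w : (Fin 3 × Fin 3) ⊕ Fin 3 → ℤ} {q : Fin 4 → ℤ} {ρS e0S cN Kc K Mx : ℤ}
    (h : uCollarLeafBOK c₀ w₀ q ρS e0S cN Kc K Mx c w = true) : semOKHQ μ c w = true :=
  semOKHQ_of_sound (uCollarLeafBOK c₀ w₀ q ρS e0S cN Kc K Mx)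
    (fun _ _ hv U ξ _ _ hU hξ hbox hξb _ _ => by
      simp only [uCollarLeafBOK, Bool.and_eq_true] at hv
      exact hcpLeafGoal_of_uCollarCellBOK hv.1 hv.2 U ξ hU hξ hbox hξb μ) h

/-- ★★ **A LIST OF U-COLLAR CELLS (2nd ed.) OVER ONE THIN CERTIFICATE** ⟹ `semOKHQ` facts, every level. [formal bookkeeping] -/
theorem semFactsQ_of_uCollarLeavesBOK {μ : ℤ} {c₀ w₀ : (Fin 3 × Fin 3) ⊕ Fin 3 → ℤ} {q : Fin 4 → ℤ} {ρS e0S cN Kc : ℤ}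
    {L : List (ℤ × ℤ × ((Fin 3 × Fin 3) ⊕ Fin 3 → ℤ) × ((Fin 3 × Fin 3) ⊕ Fin 3 → ℤ))}
    (h : uCollarLeavesBOK c₀ w₀ q ρS e0S cN Kc L = true) : ∀ b ∈ L, semOKHQ μ b.2.2.1 b.2.2.2 = true := by
  simp only [uCollarLeavesBOK, Bool.and_eq_true] at h
  intro b hb
  refine semOKHQ_of_uCollarLeafBOK (q := q) (e0S := e0S) (c₀ := c₀) (w₀ := w₀) (ρS := ρS) (cN := cN) (Kc := Kc) (K := b.1) (Mx := b.2.1) ?_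
  simp only [uCollarLeafBOK, Bool.and_eq_true]
  exact ⟨List.all_eq_true.1 h.2 b hb, h.1⟩

/-- The same facts on the `(c, w)` projections. [formal bookkeeping] -/
theorem semFactsQ_of_uCollarLeavesBOK_map {μ : ℤ} {c₀ w₀ : (Fin 3 × Fin 3) ⊕ Fin 3 → ℤ} {q : Fin 4 → ℤ} {ρS e0S cN Kc : ℤ}
    {L : List (ℤ × ℤ × ((Fin 3 × Fin 3) ⊕ Fin 3 → ℤ) × ((Fin 3 × Fin 3) ⊕ Fin 3 → ℤ))}
    (h : uCollarLeavesBOK c₀ w₀ q ρS e0S cN Kc L = true) : ∀ b ∈ L.map fun b => b.2.2, semOKHQ μ b.1 b.2 = true := by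
  intro b hb
  obtain ⟨a, ha, rfl⟩ := List.mem_map.1 hb
  exact semFactsQ_of_uCollarLeavesBOK h a ha

end Summit.AtomisticToContinuum.Crystallization.Theorems.FrustratedLawDichotomyStrainedPatchHomEntryFitHcpUCollarLeafB

end
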